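import Literature.AnabelianGeometry.EtaleTheta.TemperedFrobenioidOfGaloisCoveringTateTowerArith
import Literature.AnabelianGeometry.EtaleTheta.LogDivisorModelTateTowerArithmeticPadic
import Literature.AnabelianGeometry.EtaleTheta.Discharge.Sec3Thm37iNode
import Literature.AnabelianGeometry.EtaleTheta.Discharge.Sec3Def36iOfGaloisCovering
import Literature.AnabelianGeometry.EtaleTheta.Discharge.Sec3Prop34iiConstField
import Literature.AlgebraicGeometry.Frobenioids.PadicFrobenioidQp
import HarnessLib

/-!
# [EtTh] Theorem 3.7 (i) at a `Λ = ℤ` model with a GENUINE p-adic constant field: the Prop. 3.4 (ii) binder `hP34`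
# («`Ker(B₀ → Φ₀^gp) ≅ O_L^×` for a p-adic local field `L`») is a THEOREM at the arithmetic Tate tower over `ℚ_p`,
# hence all seven printed clauses of Thm. 3.7 (i) — clause (1) «unit-profinite» by PRINT'S ROUTE — with NO binder

S. Mochizuki, *The étale theta function and its Frobenioid-theoretic manifestations*, Publ. RIMS **45** (2009) [EtTh], §3:
Prop. 3.4 (ii), PRIMS PDF p.74 ("`O_L^× ⥲ Ker(B₀(Y^log) → Φ₀^gp(Y^log))`"); Theorem 3.7 (i), statement PDF p.79 (printed
p.305) ll.30–31, proof PDF p.80 ll.8–15 ("By Proposition 3.4, (ii) … if `Λ = ℤ` … unit-profinite"); Theorem 3.7 (iv), p.80 l.7;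
[FrdII] Thm. 1.2 (i) (unit-profinite `p`-adic Frobenioids) [cite: MochizukiEtTh2009, Thm 3.7 (i) p.79].

PROOF-ONLY companion (theorems only: no `def`, no `Prop` fact, no instance, no notation; abc-iut cell, layer L2, cone node
**`EtTh:Thm3.7(i)`**; abc-iut-L2-lead gen 7 R1023 residual of record «`hP34` (Prop. 3.4 (ii) iso 1); no p-adic `O_L^×` model
carrier» and R1086 «GO hP34 CARRIER for Thm3.7(i): p-adic `O_L^×` model»; seat abc-iut-w6-d061 gen 6/7).  Nothing landed is
edited or restated; everything is consumed BY NAME.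

abc-iut-w4-d103's node closer `TemperedFrobenioid.thm37_i_node (hBmon) (hP34) (hinj)` (`Sec3Thm37iNode`, p455829) carries, for
`Λ = ℤ`, the binder `hP34` = Prop. 3.4 (ii) isomorphism 1 in tree currency: at every object `A` of the base, SOME p-adic local
field `L` with `Ker(B₀^Λ(Y)ˣ → (Φ₀^ℝ)^gp(Y)) ≃* O_L^× = PadicFrd.unitSubgroup L.K` (`Y` the image of `A` in `D₀`).  At the
combinatorial `Λ = ℤ` models of record (ℤ-tower `ZTowerTempered.temperedFrobenioid`, abc-iut-w5-d179's
`Sec3Thm37iNodeGenuineBase` §4) the unit groups are FINITE, so `hP34` stays a binder there (the degenerate finite-kernel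
route is deliberately not taken).  THIS FILE discharges it at the one model of record whose constants ARE a p-adic local
field: the ARITHMETIC Tate tower over the MLF `ℚ_p` — abc-iut-w6-d058's `TateTowerArithFrd.temperedFrobenioid D R S`
(p450534 lineage; `Λ = ℤ` weak data `ofRlfZWeak`, base `pt ↦ G/G`) at abc-iut-w5-d223's datum `TateTowerArith.Datum.padic p`
(`K = L = ℚ_p`, `v` = the `p`-adic valuation, `q = p`):
* §0 `PadicDivisible.valuation_primeSpec_eq_one_iff_norm` / `…_iff_valuativeRel` — the bookkeeping bridge between the
  datum's valuation (`HeightOneSpectrum.valuation` of `(p) ⊆ ℤ_[p]`) and Mathlib's valuative relation on `ℚ_p` (through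
  `‖·‖ = 1`), so that «`v c = 1`» reads «`c ∈ PadicFrd.unitSubgroup ℚ_[p] = ℤ_p^×`»;
* §1 `TateTowerArithFrd.divΛ_top_eq_one_iff` — at `G/G`, `divΛ b = 1 ↔ div₀ b = 1` (abc-iut-w6-d058's
  `DivisorMonoids.ker_divΛ_rlfZ_ofGaloisActionConnected` + abc-iut-L6-d1/w5-d124's `GaloisAction.divZeroHom_eq_one_iff`);
  `TateTowerArithFrd.exists_eq_emb_of_mem_ker_padic` — a unit of `B₀(G/G)` in the kernel is the `K`-rational constant family
  `c·U⁰` with `v c = 1` (abc-iut-w6-d058's `ConstField.divZeroHom_quotient_eq_one_iff` at `Datum.constField`, `H = ⊤`);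
* §2 **`TateTowerArithFrd.nonempty_ker_mulEquiv_padicUnits`** — `Ker(B₀(G/G)ˣ → (Φ₀^rlf)^gp(G/G)) ≃* ℤ_p^×`
  (`u ↦` the value `c` at the base point; inverse `c ↦ c·U⁰`), and **`TateTowerArithFrd.hP34_padic`** — the LITERAL `hP34`
  binder of `thm37_i_node` at `TateTowerArithFrd.temperedFrobenioid (Datum.padic p) R S`, with `L := PadicFrd.qpFld p`
  (abc-iut-L1-t4's `isPadicLocal_qpFld`): **Prop. 3.4 (ii) iso 1 is a THEOREM at this model**;
* §3 **`TateTowerArithFrd.thm37_i_temperedFrobenioid_padic`** — [EtTh] Thm. 3.7 (i), ALL SEVEN printed clauses, NO binder,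
  at a `Λ = ℤ` model: clause (1) «unit-profinite» by PRINT'S ROUTE (Prop. 3.4 (ii) iso 1 + [FrdII] Thm. 1.2 (i)
  `PadicFld.admitsTfgProfiniteTopology_unitSubgroup`, inside abc-iut-w5-d164's `isOfUnitProfiniteType_of_kerIsoPadicUnits`),
  `hBmon := Cor38Toy.isMonoidOn_of_punit`, `hinj` vacuous (`Λ = ℤ ≠ ℝ`); `isOfUnitProfiniteType_temperedFrobenioid_padic`;
  and the typed **`Thm37_iv`** (`thm37_iv_temperedFrobenioid_padic`, via `thm37_iv_of_kerIsoPadicUnits` with `hF :=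
  isFrobenioid_temperedFrobenioid_byName`) — the NON-degenerate companions of `ZTowerTempered.thm37_i_node_temperedFrobenioid (hP34)`.
HONEST FRAMING: refereed pre-IUT material ([EtTh] §3 over [FrdI] §§1–5, [FrdII] Thm. 1.2 (i)); the model is a class-(b)
arithmetic consistency witness over ONE point of `D₀` (not the formal-scheme Tate tower); bookkeeping over PROVED rows, no new
mathematics; nothing here bears on [IUTchIII] Cor. 3.12; no side taken; typed ≠ proved — here PROVED with no binder.
-/

noncomputable section

namespace Literature.AnabelianGeometry.EtaleTheta

open CategoryTheory Opposite Function Literature.AlgebraicGeometry.Frobenioids IsDedekindDomain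

/-! ### §0 The valuation bridge on `ℚ_p`: datum valuation `= 1` ↔ `‖·‖ = 1` ↔ valuative relation `= 1` -/

namespace PadicDivisible

variable (p : ℕ) [hp : Fact p.Prime]

/-- For `x ≠ 0` in `ℚ_p`: the `(p)`-adic valuation of `ℤ_[p]` (extended to `ℚ_[p]`) takes the value `1` at `x` iff `‖x‖ = 1`,
i.e. iff `x ∈ ℤ_p^×` (the valuation ring of this valuation is `ℤ_[p]`, a local ring with maximal ideal `(p)`).
[cite: MochizukiFrdII2008, Ex 1.1 (i) p.7] -/
theorem valuation_primeSpec_eq_one_iff_norm {x : ℚ_[p]} (hx : x ≠ 0) :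
    (primeSpec p).valuation ℚ_[p] x = 1 ↔ ‖x‖ = 1 := by
  rcases le_or_gt ‖x‖ 1 with h | h
  · -- `x ∈ ℤ_[p]`: valuation `1` iff `x ∉ (p)` iff `x` is a unit iff `‖x‖ = 1`
    obtain ⟨z, rfl⟩ : ∃ z : ℤ_[p], (z : ℚ_[p]) = x := ⟨⟨x, h⟩, rfl⟩
    rw [← PadicInt.algebraMap_apply, HeightOneSpectrum.valuation_eq_one_iff_notMem, PadicInt.algebraMap_apply,
      ← PadicInt.norm_def, ← PadicInt.isUnit_iff]
    exact IsLocalRing.notMem_maximalIdeal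
  · -- `‖x‖ > 1`: then `x⁻¹ ∈ (p)`, so `v(x⁻¹) < 1`, so `v x ≠ 1`; and `‖x‖ ≠ 1`
    refine ⟨fun hv => ?_, fun h1 => absurd h1 (ne_of_gt h)⟩
    have hinv : ‖x⁻¹‖ < 1 := by
      rw [norm_inv]
      exact inv_lt_one_of_one_lt₀ h
    obtain ⟨z, hz⟩ : ∃ z : ℤ_[p], (z : ℚ_[p]) = x⁻¹ := ⟨⟨x⁻¹, hinv.le⟩, rfl⟩
    have hmem : z ∈ (primeSpec p).asIdeal := by
      change z ∈ IsLocalRing.maximalIdeal ℤ_[p]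
      rw [IsLocalRing.mem_maximalIdeal, mem_nonunits_iff, PadicInt.isUnit_iff, PadicInt.norm_def, hz]
      exact hinv.ne
    have hlt : (primeSpec p).valuation ℚ_[p] (algebraMap ℤ_[p] ℚ_[p] z) < 1 :=
      ((primeSpec p).valuation_lt_one_iff_mem (K := ℚ_[p]) z).2 hmem
    have hz' : algebraMap ℤ_[p] ℚ_[p] z = x⁻¹ := by rw [PadicInt.algebraMap_apply, hz]
    rw [hz', map_inv₀, hv, inv_one] at hlt
    exact absurd hlt (lt_irrefl _)

/-- For `x ≠ 0` in `ℚ_p`: Mathlib's valuative relation on `ℚ_p` (from `Padic.mulValuation`) takes the value `1` at `x` iff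
`‖x‖ = 1` (abc-iut-L1-t4's `PadicFrd.padic_eq_one_iff` + `Padic.norm_eq_zpow_neg_valuation`).
[cite: MochizukiFrdII2008, Ex 1.1 (i) p.7] -/
theorem valuativeRel_valuation_eq_one_iff_norm {x : ℚ_[p]} (hx : x ≠ 0) :
    ValuativeRel.valuation ℚ_[p] x = 1 ↔ ‖x‖ = 1 := by
  rw [PadicFrd.padic_eq_one_iff p hx, Padic.norm_eq_zpow_neg_valuation hx,
    zpow_eq_one_iff_right₀ (Nat.cast_nonneg p) (by exact_mod_cast hp.out.one_lt.ne'), neg_eq_zero]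

/-- **The bridge**: for a unit `c ∈ ℚ_p^×`, «`v c = 1`» for the datum's `(p)`-adic valuation iff `c ∈ ℤ_p^× =
PadicFrd.unitSubgroup ℚ_[p]` (valuative-relation form). [cite: MochizukiFrdII2008, Ex 1.1 (i) p.7] -/
theorem valuation_primeSpec_eq_one_iff_mem_unitSubgroup (c : ℚ_[p]ˣ) :
    (primeSpec p).valuation ℚ_[p] (c : ℚ_[p]) = 1 ↔ c ∈ PadicFrd.unitSubgroup ℚ_[p] := by
  rw [PadicFrd.mem_unitSubgroup_iff, valuation_primeSpec_eq_one_iff_norm p c.ne_zero,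
    valuativeRel_valuation_eq_one_iff_norm p c.ne_zero]

end PadicDivisible

/-! ### §1 The kernel of `B₀(G/G)ˣ → (Φ₀^rlf)^gp(G/G)` at the arithmetic Tate tower over `ℚ_p` -/

namespace TateTowerArithFrd

open LogDivisorModel LogDivisorModel.GaloisAction LogDivisorModel.TateTowerArith PadicDivisible

variable (p : ℕ) [hp : Fact p.Prime] (R S : ((Discrete PUnit.{1})ᵒᵖ ⥤ CommMonCat.{0}) → Prop)

/-- At the one-point covering `G/G` of the arithmetic Tate tower (any datum `D`): an element `b ∈ B₀^ℤ(G/G) = B₀(G/G)` has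
trivial `Λ`-divisor in `(Φ₀^rlf)^gp(G/G)` iff its log-divisor `div₀ b ∈ Φ₀^gp(G/G)` is trivial (`Φ₀ → Φ₀^rlf` is injective on
the divisorial monoid `Φ₀(G/G)`: abc-iut-w6-d058's `ker_divΛ_rlfZ_ofGaloisActionConnected` with `GaloisAction.divZeroHom_eq_one_iff`).
[cite: MochizukiEtTh2009, Prop 3.4 p.74] -/
theorem divΛ_top_eq_one_iff {K L : Type} [Field K] [Field L] [Algebra K L] (D : Datum K L)
    (b : (RealifiedDivisorMonoids.ofRlfZWeak (dm D) (hpf D)).BΛ.obj (op (top K L))) :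
    (RealifiedDivisorMonoids.ofRlfZWeak (dm D) (hpf D)).divΛ (op (top K L)) b = 1 ↔
      D.action.divZeroHom (top K L).obj b = 1 := by
  constructor
  · intro hb
    exact (D.action.divZeroHom_eq_one_iff (top K L).obj b).2
      (DivisorMonoids.ker_divΛ_rlfZ_ofGaloisActionConnected D.action D.cuspLaws (fun _ => True) (fun _ => True)
        (op (top K L)) b hb)
  · intro hb
    rw [RealifiedDivisorMonoids.ofRlfZWeak_divΛ_apply]
    change EtaleTheta.gpMap _ (D.action.divZeroHom (top K L).obj b) = 1
    rw [hb]
    exact map_one _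

/-- At the `ℚ_p`-tower: a unit `u` of `B₀(G/G)` in the kernel of `B₀(G/G)ˣ → (Φ₀^rlf)^gp(G/G)` is the `K`-rational constant
family whose value at the base point is `c·U⁰` for a (unique) `c ∈ ℚ_p^×` with `v c = 1` (Prop. 3.4 (ii) iso 1 in print's form,
abc-iut-w6-d058's `ConstField.divZeroHom_quotient_eq_one_iff` at `Datum.constField`, `H = ⊤`). [cite: MochizukiEtTh2009, Prop 3.4 p.74] -/
theorem exists_eq_emb_of_mem_ker_padic
    (u : ((RealifiedDivisorMonoids.ofRlfZWeak (dm (Datum.padic p)) (hpf (Datum.padic p))).BΛ.obj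
      (op (top ℚ_[p] ℚ_[p])))ˣ)
    (hu : u ∈ (((RealifiedDivisorMonoids.ofRlfZWeak (dm (Datum.padic p)) (hpf (Datum.padic p))).divΛ
        (op (top ℚ_[p] ℚ_[p]))).comp (Units.coeHom _)).ker) :
    ∃ c : ℚ_[p]ˣ, (primeSpec p).valuation ℚ_[p] (c : ℚ_[p]) = 1 ∧
      (u : (RealifiedDivisorMonoids.ofRlfZWeak (dm (Datum.padic p)) (hpf (Datum.padic p))).BΛ.obj
        (op (top ℚ_[p] ℚ_[p]))).1 (s₀ ℚ_[p] ℚ_[p]) = ((c, 1) : (Datum.padic p).model.Fn) := by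
  rw [MonoidHom.mem_ker, MonoidHom.comp_apply, Units.coeHom_apply, divΛ_top_eq_one_iff] at hu
  obtain ⟨c, -, hv, hc⟩ := ((Datum.padic p).constField.divZeroHom_quotient_eq_one_iff ⊤ _).1 hu
  exact ⟨c, hv, hc⟩

/-- Conversely, at the `ℚ_p`-tower the constant family `c·U⁰` (`c ∈ ℚ_p^×`) lies in `B₀(G/G)` (it is `ℤ × Aut(ℚ_p/ℚ_p)`-invariant).
[cite: MochizukiEtTh2009, Def 3.3 p.73] -/
theorem constFamily_mem_bZero_padic (c : ℚ_[p]ˣ) :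
    (fun _ : (top ℚ_[p] ℚ_[p]).obj.V => ((c, 1) : (Datum.padic p).model.Fn)) ∈ (Datum.padic p).action.bZero (top ℚ_[p] ℚ_[p]).obj := by
  refine ⟨fun _ => trivial, fun g _ => ?_⟩
  change ((c, 1) : ℚ_[p]ˣ × Multiplicative ℤ) = (Datum.padic p).act g (c, 1)
  refine Prod.ext ?_ rfl
  rw [Datum.act_fst, toAdd_one, zero_mul, neg_zero, zpow_zero, mul_one]
  refine Units.ext ?_
  rw [Units.coe_map, MonoidHom.coe_coe]
  have h := (g.2).commutes (c : ℚ_[p])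
  rw [Algebra.algebraMap_self_apply] at h
  exact h.symm

/-- … and, when `v c = 1`, has trivial log-divisor: `div₀(c·U⁰) = 1`. [cite: MochizukiEtTh2009, Prop 3.4 p.74] -/
theorem divZeroHom_constFamily_padic (c : ℚ_[p]ˣ) (hc : (primeSpec p).valuation ℚ_[p] (c : ℚ_[p]) = 1) :
    (Datum.padic p).action.divZeroHom (top ℚ_[p] ℚ_[p]).obj ⟨_, constFamily_mem_bZero_padic p c⟩ = 1 := by
  refine ((Datum.padic p).constField.divZeroHom_quotient_eq_one_iff ⊤ _).2 ⟨c, ?_, hc, rfl⟩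
  rw [(Datum.padic p).constField.mem_fixedField_map_iff]
  intro g _
  have h := (g.2).commutes (c : ℚ_[p])
  rwa [Algebra.algebraMap_self_apply] at h

/-! ### §2 Prop. 3.4 (ii) isomorphism 1 — the `hP34` binder — is a THEOREM at the `ℚ_p`-tower -/

/-- **`Ker(B₀(G/G)ˣ → (Φ₀^rlf)^gp(G/G)) ≃* ℤ_p^× = PadicFrd.unitSubgroup ℚ_[p]`** at the arithmetic Tate tower over `ℚ_p`
(Prop. 3.4 (ii), isomorphism 1, with a GENUINE p-adic `O_L^×`): `u ↦ c`, the value of the `K`-rational constant family `u = c·U⁰`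
at the base point; inverse `c ↦ c·U⁰`. [cite: MochizukiEtTh2009, Prop 3.4 p.74] -/
theorem nonempty_ker_mulEquiv_padicUnits :
    Nonempty ((((RealifiedDivisorMonoids.ofRlfZWeak (dm (Datum.padic p)) (hpf (Datum.padic p))).divΛ
        (op (top ℚ_[p] ℚ_[p]))).comp (Units.coeHom ((RealifiedDivisorMonoids.ofRlfZWeak (dm (Datum.padic p))
          (hpf (Datum.padic p))).BΛ.obj (op (top ℚ_[p] ℚ_[p]))))).ker ≃* PadicFrd.unitSubgroup ℚ_[p]) := by
  -- the evaluation homomorphism `u ↦ (u(s₀)).1 : B₀(G/G)ˣ →* ℚ_p^×`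
  let ev : ((RealifiedDivisorMonoids.ofRlfZWeak (dm (Datum.padic p)) (hpf (Datum.padic p))).BΛ.obj
      (op (top ℚ_[p] ℚ_[p])))ˣ →* ℚ_[p]ˣ :=
    { toFun := fun u => ((u : (RealifiedDivisorMonoids.ofRlfZWeak (dm (Datum.padic p)) (hpf (Datum.padic p))).BΛ.obj
        (op (top ℚ_[p] ℚ_[p]))).1 (s₀ ℚ_[p] ℚ_[p])).1
      map_one' := rfl
      map_mul' := fun _ _ => rfl }
  have hev : ∀ u ∈ (((RealifiedDivisorMonoids.ofRlfZWeak (dm (Datum.padic p)) (hpf (Datum.padic p))).divΛ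
      (op (top ℚ_[p] ℚ_[p]))).comp (Units.coeHom _)).ker, ev u ∈ PadicFrd.unitSubgroup ℚ_[p] := fun u hu => by
    obtain ⟨c, hv, hc⟩ := exists_eq_emb_of_mem_ker_padic p u hu
    have hcu : ev u = c := congrArg Prod.fst hc
    rw [hcu]
    exact (valuation_primeSpec_eq_one_iff_mem_unitSubgroup p c).1 hv
  let f := (ev.comp (Subgroup.subtype _)).codRestrict (PadicFrd.unitSubgroup ℚ_[p]) fun u => hev u.1 u.2
  refine ⟨MulEquiv.ofBijective f ⟨?_, ?_⟩⟩
  · -- injective: a kernel element is determined by its base-point value `c·U⁰`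
    intro u u' h
    obtain ⟨c, -, hc⟩ := exists_eq_emb_of_mem_ker_padic p u.1 u.2
    obtain ⟨c', -, hc'⟩ := exists_eq_emb_of_mem_ker_padic p u'.1 u'.2
    have hcc : c = c' := by
      have h1 : ((f u : PadicFrd.unitSubgroup ℚ_[p]) : ℚ_[p]ˣ) = c := congrArg Prod.fst hc
      have h2 : ((f u' : PadicFrd.unitSubgroup ℚ_[p]) : ℚ_[p]ˣ) = c' := congrArg Prod.fst hc'
      rw [← h1, ← h2, h]
    refine Subtype.ext (Units.ext (Subtype.ext (funext fun s => ?_)))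
    rw [eq_s₀ s, hc, hc', hcc]
  · -- surjective: `c ↦ c·U⁰`
    rintro ⟨c, hcU⟩
    have hv : (primeSpec p).valuation ℚ_[p] (c : ℚ_[p]) = 1 := (valuation_primeSpec_eq_one_iff_mem_unitSubgroup p c).2 hcU
    let b : (RealifiedDivisorMonoids.ofRlfZWeak (dm (Datum.padic p)) (hpf (Datum.padic p))).BΛ.obj (op (top ℚ_[p] ℚ_[p])) :=
      ⟨_, constFamily_mem_bZero_padic p c⟩
    have hb : (RealifiedDivisorMonoids.ofRlfZWeak (dm (Datum.padic p)) (hpf (Datum.padic p))).divΛ (op (top ℚ_[p] ℚ_[p])) b = 1 :=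
      (divΛ_top_eq_one_iff (Datum.padic p) b).2 (divZeroHom_constFamily_padic p c hv)
    have hunit := (RealifiedDivisorMonoids.ofRlfZWeak (dm (Datum.padic p)) (hpf (Datum.padic p))).isUnit_BΛ _ b
    refine ⟨⟨hunit.unit, ?_⟩, Subtype.ext ?_⟩
    · rw [MonoidHom.mem_ker, MonoidHom.comp_apply, Units.coeHom_apply, IsUnit.unit_spec]
      exact hb
    · change ((hunit.unit : (RealifiedDivisorMonoids.ofRlfZWeak (dm (Datum.padic p)) (hpf (Datum.padic p))).BΛ.obj
        (op (top ℚ_[p] ℚ_[p]))).1 (s₀ ℚ_[p] ℚ_[p])).1 = c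
      rw [IsUnit.unit_spec]

/-- **`hP34` at the `ℚ_p`-tower — Prop. 3.4 (ii) isomorphism 1 is a THEOREM here**, in the LITERAL currency of the node closer
`TemperedFrobenioid.thm37_i_node`: at every object of the base of `TateTowerArithFrd.temperedFrobenioid (Datum.padic p) R S` the
p-adic local field `L := Spec ℚ_p` (`PadicFrd.qpFld p`, abc-iut-L1-t4's `isPadicLocal_qpFld`) has
`Ker(B₀^Λ(G/G)ˣ → (Φ₀^ℝ)^gp(G/G)) ≃* O_L^× = ℤ_p^×`. [cite: MochizukiEtTh2009, Prop 3.4 p.74] -/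
theorem hP34_padic (A : (Discrete PUnit.{1})ᵒᵖ) :
    ∃ L : PadicFrd.PadicFld.{0} p, L.IsPadicLocal ∧
      Nonempty ((((RealifiedDivisorMonoids.ofRlfZWeak (dm (Datum.padic p)) (hpf (Datum.padic p))).divΛ
          ((temperedFrobenioid (Datum.padic p) R S).baseOp A)).comp
        (Units.coeHom ((RealifiedDivisorMonoids.ofRlfZWeak (dm (Datum.padic p)) (hpf (Datum.padic p))).BΛ.obj
          ((temperedFrobenioid (Datum.padic p) R S).baseOp A)))).ker ≃* PadicFrd.unitSubgroup L.K) :=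
  ⟨PadicFrd.qpFld p, PadicFrd.isPadicLocal_qpFld p, nonempty_ker_mulEquiv_padicUnits p⟩

/-! ### §3 [EtTh] Thm. 3.7 (i) with NO binder at a `Λ = ℤ` model; unit-profinite type; the typed Thm. 3.7 (iv) -/

/-- The `ℚ_p`-tower tempered Frobenioid has monoid type `ℤ`. [cite: MochizukiEtTh2009, Def 3.6 p.77] -/
theorem temperedFrobenioid_padic_monoidType : (temperedFrobenioid (Datum.padic p) R S).monoidType = MonoidType.Z := rfl

/-- «`B` is a monoid on `D`» for the one-object base — NO binder (abc-iut-w6-d052's `Cor38Toy.isMonoidOn_of_punit`).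
[cite: MochizukiFrdI2008, Def. 1.1 (ii) p.19] -/
theorem isMonoidOn_ratFnFunctor_temperedFrobenioid_padic : IsMonoidOn (temperedFrobenioid (Datum.padic p) R S).ratFnFunctor :=
  Cor38Toy.isMonoidOn_of_punit _

/-- **[EtTh] Theorem 3.7 (i) — ALL SEVEN printed clauses with NO binder at the `Λ = ℤ` arithmetic Tate tower over `ℚ_p`**
(`TateTowerArithFrd.temperedFrobenioid (Datum.padic p) R S`): (1) unit-profinite — BY PRINT'S ROUTE "By Proposition 3.4, (ii)"
(`hP34_padic` + [FrdII] Thm. 1.2 (i)), (2) the `Λ = ℝ` clause (vacuous here), (3) isotropic, (4) model, (5) birationally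
Frobenius-normalized, (6) sub-quasi-Frobenius-trivial, (7) not group-like — abc-iut-w4-d103's `thm37_i_node` fed with
`hBmon := Cor38Toy.isMonoidOn_of_punit`, `hP34 := hP34_padic`, `hinj` vacuous. [cite: MochizukiEtTh2009, Thm 3.7 (i) p.79] -/
theorem thm37_i_temperedFrobenioid_padic :
    PreFrobenioid.IsOfUnitProfiniteType (temperedFrobenioid (Datum.padic p) R S).toElem ∧
      ((temperedFrobenioid (Datum.padic p) R S).monoidType = MonoidType.R →
        PreFrobenioid.IsOfType (PreFrobenioid.IsUnitTrivial (temperedFrobenioid (Datum.padic p) R S).toElem)) ∧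
      PreFrobenioid.IsOfIsotropicType (temperedFrobenioid (Datum.padic p) R S).toElem ∧
      PreFrobenioid.IsOfModelType (temperedFrobenioid (Datum.padic p) R S).toElem
        ((temperedFrobenioid (Datum.padic p) R S).isFrobenioid_treeCatVocab_of_isMonoidOn
          (isMonoidOn_ratFnFunctor_temperedFrobenioid_padic p R S))
        (PreFrobenioid.hasBiratSquares_of_isFrobenioid
          ((temperedFrobenioid (Datum.padic p) R S).isFrobenioid_treeCatVocab_of_isMonoidOn
            (isMonoidOn_ratFnFunctor_temperedFrobenioid_padic p R S))) ∧
      PreFrobenioidData.IsOfBiratFrobeniusNormalizedType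
        (PreFrobenioid.biratData
          ((temperedFrobenioid (Datum.padic p) R S).isFrobenioid_treeCatVocab_of_isMonoidOn
            (isMonoidOn_ratFnFunctor_temperedFrobenioid_padic p R S))
          (PreFrobenioid.hasBiratSquares_of_isFrobenioid
            ((temperedFrobenioid (Datum.padic p) R S).isFrobenioid_treeCatVocab_of_isMonoidOn
              (isMonoidOn_ratFnFunctor_temperedFrobenioid_padic p R S)))) ∧
      PreFrobenioid.IsOfType (PreFrobenioid.IsSubQuasiFrobeniusTrivial (temperedFrobenioid (Datum.padic p) R S).toElem) ∧
      ¬ PreFrobenioid.IsOfType (PreFrobenioid.IsGroupLikeObj (temperedFrobenioid (Datum.padic p) R S).toElem) :=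
  have h := (temperedFrobenioid (Datum.padic p) R S).thm37_i_node (p := p)
    (isMonoidOn_ratFnFunctor_temperedFrobenioid_padic p R S) (fun _ => hP34_padic p R S)
    (fun h => absurd ((temperedFrobenioid_padic_monoidType p R S).symm.trans h) (by decide))
  ⟨h.1 (temperedFrobenioid_padic_monoidType p R S), h.2⟩

/-- **Clause (1) alone: the `Λ = ℤ` tempered Frobenioid of the `ℚ_p`-tower is of UNIT-PROFINITE type, outright** ([FrdI]
Def. 2.8 (ii): every `O^×(A)` admits a topologically finitely generated profinite topology — here `O^×(A) ≅ ℤ_p^×`).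
[cite: MochizukiEtTh2009, Thm 3.7 (i) p.79] -/
theorem isOfUnitProfiniteType_temperedFrobenioid_padic :
    PreFrobenioid.IsOfUnitProfiniteType (temperedFrobenioid (Datum.padic p) R S).toElem :=
  (thm37_i_temperedFrobenioid_padic p R S).1

/-- **[EtTh] Theorem 3.7 (iv) AS TYPED** (abc-iut-L2-t3's `Thm37_iv`: "`D` slim, `Λ ∈ {ℤ, ℝ}` ⟹ `C` slim") at the
`ℚ_p`-tower, NO binder: abc-iut-w5-d164's `thm37_iv_of_kerIsoPadicUnits` fed with `hF := isFrobenioid_temperedFrobenioid_byName`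
(abc-iut-w5-d179) and `hP34 := hP34_padic`. [cite: MochizukiEtTh2009, Thm 3.7 (iv) p.80] -/
theorem thm37_iv_temperedFrobenioid_padic : (temperedFrobenioid (Datum.padic p) R S).Thm37_iv :=
  (temperedFrobenioid (Datum.padic p) R S).thm37_iv_of_kerIsoPadicUnits
    (isFrobenioid_temperedFrobenioid_byName (Datum.padic p) R S) (hP34_padic p R S)

end TateTowerArithFrd

end Literature.AnabelianGeometry.EtaleTheta

end
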